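import Summits.CriticalPhenomena.PercolationContinuityZ3.Theorems.PercNearOneGluingNoHeavyLowerTailKnQuestion8CoefficientwiseCoreClassKernelMixTwoStageProduct
import Summits.CriticalPhenomena.PercolationContinuityZ3.Theorems.PercNearOneGluingNoHeavyLowerTailKnQuestion8CoefficientwiseCoreClassKernelMixTwoStageChargingRegions

/-!
# The abstract rider-free step of the chordless FULL-induction (THEOREM RF, abstract form)

Support file (`--supports stmt-CriticalPhenomena-4575`, closed), prover `prim-cplus-coupling` (gen 73).  No definitions, no notations,
no named facts, no sorries; standard axioms.  Memo `prim-cplus-coupling/A5-COUPLING-gen73.md` §3.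

CONJECTURE FULL (memo gen 73 §1.2) asks, for two levels `D, B` of a chordless bouquet, for increasing bijections onto the mirrors such that
ALL coincident pairs are witnessed injectively inside the demand region `G` above their joins; in Hall form: the number of coincident pairs
whose common upper cone lies in an upper set `W` is at most `#(W ∩ G)`.  On a product `Z = X × Y` (`Y` the outermost cycle) with TWO-STAGE
maps (inner fibre maps `φ`, outer row maps `Ψ_v` indexed by the target row `v`), the coincidences split by target row and project onto the
coincidences of the outer maps of that row (`TwoStageProduct.row_bound_of_outer`); if every source lies below the LAYER `λ v` of its target
row (for the identity layering with `λ ⊤ = ⊥` this is exactly POLARITY of the fibre maps: only `⊥` is sent to `⊤`), and row `v` satisfies the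
Hall bound against its own witness region `R v` placed at layer `λ v` inside `G`, then `Z` satisfies the Hall bound against `G`
(`TwoStageChargingRegions.two_stage_charging_regions`).  This file assembles these two facts into the abstract step `two_stage_full_count`;
with `two_stage_increasing` / `two_stage_mirror` / `two_stage_injOn` it is THEOREM RF of the memo once instantiated on a bouquet (rows
`v ≠ ⊤`: chordless row pairs with `R v = G_X`, `λ v = v`; row `⊤`: the chorded pair `(D_⊥, B_⊥)` with THEOREM A's maps, `R ⊤ = NF_X`, `λ ⊤ = ⊥`).
[cite: KozmaNitzan2024, Questions 8–9 (§5.5 p. 36) (context); Harris 1960; Kleitman 1966]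
-/

namespace Summit.CriticalPhenomena.PercolationContinuityZ3.Theorems.Coefficientwise.TwoStageFull

open Finset ReducedKleitman TwoStageProduct TwoStageChargingRegions

variable {X Y : Type*} [Fintype X] [DecidableEq X] [Preorder X] [Fintype Y] [DecidableEq Y] [Preorder Y]

open Classical in
/-- **Abstract rider-free FULL step.**  Two levels `D, B ⊆ X × Y` with two-stage maps `Φ^D (x,y) = (ΨD (φD x y) x, φD x y)`,
`Φ^B` likewise (inner maps mirror-valued and injective on fibres), target rows in `NEY`, an injective layer map `λ` on `NEY`, witness regions
`R v ⊆ X` with `R v × {λ v} ⊆ G`, every source of `D` (resp. `B`) below the layer of its target row, and in every row `v` the Hall bound for the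
coincidences of the outer maps `ΨD v, ΨB v` on the row levels `D_{cY v} × B_{cY v}` against `R v`.  Then the coincidences `Φ^D z₁ = Φ^B z₂`,
`(z₁,z₂) ∈ D × B`, satisfy the Hall bound against `G`: those whose common upper cone lies in an upper set `W` number at most `#(W ∩ G)`. -/
theorem two_stage_full_count (D B : Finset (X × Y)) (cY : Y → Y) (φD φB : X → Y → Y) (ΨD ΨB : Y → X → X)
    (NEY : Finset Y) (lam : Y → Y) (R : Y → Finset X) (G : Finset (X × Y))
    (hinD : ∀ x y, (x, y) ∈ D → (x, cY (φD x y)) ∈ D) (hinB : ∀ x y, (x, y) ∈ B → (x, cY (φB x y)) ∈ B)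
    (hinD_inj : ∀ x y y', (x, y) ∈ D → (x, y') ∈ D → φD x y = φD x y' → y = y')
    (hinB_inj : ∀ x y y', (x, y) ∈ B → (x, y') ∈ B → φB x y = φB x y' → y = y')
    (hrowD : ∀ x y, (x, y) ∈ D → φD x y ∈ NEY)
    (hlam : Set.InjOn lam (NEY : Set Y)) (hR : ∀ v ∈ NEY, ∀ x ∈ R v, (x, lam v) ∈ G)
    (hlayD : ∀ x y, (x, y) ∈ D → y ≤ lam (φD x y)) (hlayB : ∀ x y, (x, y) ∈ B → y ≤ lam (φB x y))
    (hH : ∀ v ∈ NEY, ∀ U : Finset X, IsUpperSet (U : Set X) →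
      (((fibR D (cY v) ×ˢ fibR B (cY v)).filter (fun p => ΨD v p.1 = ΨB v p.2)).filter
        (fun p => ∀ q : X, p.1 ≤ q → p.2 ≤ q → q ∈ U)).card ≤ (U ∩ R v).card)
    (W : Finset (X × Y)) (hW : IsUpperSet (W : Set (X × Y))) :
    (((D ×ˢ B).filter (fun c => (ΨD (φD c.1.1 c.1.2) c.1.1, φD c.1.1 c.1.2) = (ΨB (φB c.2.1 c.2.2) c.2.1, φB c.2.1 c.2.2))).filter
        (fun c => ∀ q : X × Y, c.1 ≤ q → c.2 ≤ q → q ∈ W)).card ≤ (W ∩ G).card := by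
  set Coll := (D ×ˢ B).filter
    (fun c => (ΨD (φD c.1.1 c.1.2) c.1.1, φD c.1.1 c.1.2) = (ΨB (φB c.2.1 c.2.2) c.2.1, φB c.2.1 c.2.2)) with hColl
  set row : (X × Y) × (X × Y) → Y := fun c => φD c.1.1 c.1.2 with hrowdef
  -- membership facts for a collision
  have hmem : ∀ c ∈ Coll, (c.1.1, c.1.2) ∈ D ∧ (c.2.1, c.2.2) ∈ B ∧ φD c.1.1 c.1.2 = φB c.2.1 c.2.2 := by
    intro c hc
    obtain ⟨hcDB, hcoll⟩ := mem_filter.mp hc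
    obtain ⟨hD, hB⟩ := mem_product.mp hcDB
    simp only [Prod.mk.injEq] at hcoll
    exact ⟨by simpa using hD, by simpa using hB, hcoll.2⟩
  have hrow : ∀ c ∈ Coll, row c ∈ NEY := by
    intro c hc
    obtain ⟨hD, _, _⟩ := hmem c hc
    exact hrowD c.1.1 c.1.2 hD
  have hyj : ∀ c ∈ Coll, c.1.2 ≤ lam (row c) ∧ c.2.2 ≤ lam (row c) := by
    intro c hc
    obtain ⟨hD, hB, he⟩ := hmem c hc
    refine ⟨hlayD c.1.1 c.1.2 hD, ?_⟩
    show c.2.2 ≤ lam (φD c.1.1 c.1.2)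
    rw [he]
    exact hlayB c.2.1 c.2.2 hB
  -- per-row bound from the outer bound
  have hX : ∀ v ∈ NEY, ∀ U : Finset X, IsUpperSet (U : Set X) →
      ((Coll.filter (fun c => row c = v)).filter
          (fun c => ∀ p : X, c.1.1 ≤ p → c.2.1 ≤ p → p ∈ U)).card ≤ (U ∩ R v).card := by
    intro v hv U hU
    have h := row_bound_of_outer D B cY φD φB ΨD ΨB hinD hinB hinD_inj hinB_inj (R v) v U (hH v hv U hU)
    refine le_trans (le_of_eq ?_) h
    congr 1
    ext c
    simp only [hColl, hrowdef, mem_filter, and_assoc]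
  exact two_stage_charging_regions NEY G Coll row lam R hrow hlam hR hyj hX W hW

end Summit.CriticalPhenomena.PercolationContinuityZ3.Theorems.Coefficientwise.TwoStageFull
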